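import Summits.ValiantsHypothesis.ValiantsHypothesis.Theorems.BarrierLeverAnchoredDoorHitsLowerPairsWApexSpec
import Summits.ValiantsHypothesis.ValiantsHypothesis.Theorems.BarrierLeverAnchoredDoorHitsLowerPairsRelApexLemma

/-!
# Support item `AnchoredDoorHitsLowerPairs` (stmt-ValiantsHypothesis-22510), line `anchored-peeling`:
# THE WEIGHTED RELATIVE APEX LEMMA — signed tail weights, weighted roots, labels `W` (coefficient `Σ_{γ∈W} α_γ`) and `W ∖ γ` (coefficient `β_γ`)

Helper file (`--supports stmt-ValiantsHypothesis-22510`; cell valiant-natproofs, rung V4, 𝒟-side door (c); registered line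
`Cruxes/AnchoredDoorHitsLowerPairs/Lines/anchored_peeling.lean` v25, registered residual `Stmt.stub_ltRestNonCanonRS`; prover seat val-np-p1 gen 25;
memo HOME/val-np-p1/g25/MEMO-weighted-apex-valnp1-g25.md). Closes NO item. Sequel: `…WApexRecursion`.

WHY. In the typed relative Apex Lemma (`indepColsR_apexT`, file `…RelApexLemma`, val-np-p1 g22) a column `Y ∌ v⋆` carries the bottom label `Y` as soon
as `Y` MEETS the tail set `G₁` (coefficient `|Y ∩ G₁| ≠ 0`). With ARBITRARY weights (`…WApexSpec`: `D_γ = D''_γ(1 + α_γ x_n) + β_γ x_n`) the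
coefficient of the label `Y` is `Σ_{γ∈Y} α_γ`, which may VANISH although `Y` meets the support of `α` («balanced» columns): the label set of `Y` is
`labelsW α β Y = {Y | Σ_{γ∈Y} α_γ ≠ 0} ∪ {Y ∖ γ : γ ∈ Y, β_γ ≠ 0}`. The linear algebra of the lemma is unchanged (each lifted column owns a private
label outside the link; all labels lie in `link ∪ λ(T)`), so:

**THE LEMMA (`indepColsR_apexW`).** Rows `R` split into `delFam R n` / `linkFam R n`, columns `F` into `F' = delFam F v⋆` and the link `L = linkFam F v⋆`;
`T ⊆ F'` lifted columns with chosen labels `λ(Y) ∈ labelsW α β Y ∖ L`, owned by one column each, every label of every column of `F'` in `L ∪ λ(T)`. If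
`F' ∖ T` is independent on `delFam R n` and `L ∪ λ(T)` on `linkFam R n` (doors off `x_n`), then `F` is independent on `R` for the weighted apex
specialisation. The typed lemma is the case `α = tailInd G₁`, `β = rootInd G₂` (`labelsW_indicator`). With signed `α` the liftable sets `T` are the
complements of LEVEL SETS `{Y : Σ_{γ∈Y} α_γ = 0}` instead of «the columns avoiding `G₁`» — the freedom that decomposes `(R₃, K₇)`, `(R₄, K₁₅)`, the g21
exception #881 and `cube₇ − top` versus `tB(9, 3)` (memo §2–§3).

WHAT THIS IS NOT: no claim about which pairs admit such a split; nothing on crux stmt-ValiantsHypothesis-14610 or on `VP` versus `VNP`.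
-/

set_option linter.dupNamespace false

namespace Summit.ValiantsHypothesis.ValiantsHypothesis.Theorems.BarrierLever.AnchoredPeeling

open Finset MvPolynomial
open Summit.ValiantsHypothesis.ValiantsHypothesis.Theorems.BarrierLever.BrickCalculus (pexpo pexpo_def pexpo_le_iff pexpo_sub
  pexpo_apply_castAdd pexpo_apply_natAdd)

noncomputable section

variable {h : ℕ}

/-! ## Weighted labels and the weighted relative Apex Lemma -/

/-- The bottom LABELS of a column `Y ∌ v⋆` under the weighted specialisation: `Y` itself if `Σ_{γ∈Y} α_γ ≠ 0`, and `Y ∖ γ` for `γ ∈ Y` with `β_γ ≠ 0`. -/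
def labelsW (α β : Fin h → ℂ) (Y : Finset (Fin h)) : Finset (Finset (Fin h)) :=
  (if (∑ γ ∈ Y, α γ) ≠ 0 then {Y} else ∅) ∪ (Y.filter (fun γ => β γ ≠ 0)).image (fun γ => Y.erase γ)

/-- Membership in the weighted label family. -/
theorem mem_labelsW {α β : Fin h → ℂ} {Y μ : Finset (Fin h)} :
    μ ∈ labelsW α β Y ↔ (μ = Y ∧ (∑ γ ∈ Y, α γ) ≠ 0) ∨ ∃ γ ∈ Y, β γ ≠ 0 ∧ Y.erase γ = μ := by
  classical
  rw [labelsW, Finset.mem_union, Finset.mem_image]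
  have h2 : (∃ γ ∈ Y.filter (fun γ => β γ ≠ 0), Y.erase γ = μ) ↔ ∃ γ ∈ Y, β γ ≠ 0 ∧ Y.erase γ = μ := by
    constructor
    · rintro ⟨γ, hγ, hμ⟩
      exact ⟨γ, (Finset.mem_filter.mp hγ).1, (Finset.mem_filter.mp hγ).2, hμ⟩
    · rintro ⟨γ, hγ, hβ, hμ⟩
      exact ⟨γ, Finset.mem_filter.mpr ⟨hγ, hβ⟩, hμ⟩
  rw [h2]
  by_cases hne : (∑ γ ∈ Y, α γ) ≠ 0
  · rw [if_pos hne, Finset.mem_singleton]; simp only [hne, ne_eq, not_false_eq_true, and_true]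
  · rw [if_neg hne]; simp only [Finset.notMem_empty, hne, and_false, false_or]

/-- For indicator weights `Σ_{γ∈Y} [γ ∈ G₁] ≠ 0 ↔ Y` meets `G₁`. -/
theorem sum_tailInd_ne_zero_iff' (G₁ Y : Finset (Fin h)) : (∑ γ ∈ Y, tailInd G₁ γ) ≠ 0 ↔ (Y ∩ G₁).Nonempty :=
  sum_tailInd_ne_zero_iff Y

/-- **The typed labels are the weighted labels with indicator weights.** -/
theorem labelsW_indicator (G₁ G₂ Y : Finset (Fin h)) : labelsW (tailInd G₁) (rootInd G₂) Y = labelsT G₁ G₂ Y := by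
  classical
  ext μ
  rw [mem_labelsW, mem_labelsT, sum_tailInd_ne_zero_iff' G₁ Y]
  apply or_congr Iff.rfl
  constructor
  · rintro ⟨γ, hγ, hβ, hμ⟩
    have hG : γ ∈ G₂ := by
      by_contra hnot
      exact hβ (by rw [rootInd, if_neg hnot])
    exact ⟨γ, Finset.mem_inter.mpr ⟨hγ, hG⟩, hμ⟩
  · rintro ⟨γ, hγ, hμ⟩
    refine ⟨γ, (Finset.mem_inter.mp hγ).1, ?_, hμ⟩
    rw [rootInd, if_pos (Finset.mem_inter.mp hγ).2]; exact one_ne_zero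

/-- Erasing distinct members of `Y` gives distinct sets: the fibre of `γ ↦ Y ∖ γ` over `Y ∖ γ` inside `Y` is `{γ}`. -/
theorem filter_erase_eq_erase {Y : Finset (Fin h)} {γ : Fin h} (hγ : γ ∈ Y) :
    Y.filter (fun γ' => Y.erase γ' = Y.erase γ) = {γ} := by
  classical
  ext γ'
  rw [Finset.mem_filter, Finset.mem_singleton]
  constructor
  · rintro ⟨hγ', heq⟩
    exact Finset.erase_injOn Y hγ' hγ heq
  · rintro rfl
    exact ⟨hγ, rfl⟩

/-- **THE WEIGHTED RELATIVE APEX LEMMA.** See the file header. Rows `R` split into `delFam R n` and `linkFam R n`; columns `F` split by the apex `v⋆` into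
`F' = delFam F v⋆` and the link `L = linkFam F v⋆`; `T ⊆ F'` are the lifted columns with chosen labels `λ(Y) ∈ labelsW α β Y`, not in `L`, owned by
one column each, and every label of every column of `F'` lies in `L ∪ λ(T)`. If `F' ∖ T` is independent on `delFam R n` and `L ∪ λ(T)` on `linkFam R n`
(doors `θ'', φ''` off `x_n`), then `F` is independent on `R` for the weighted apex specialisation with tail weights `α` and root weights `β`. -/
theorem indepColsR_apexW {n vs : Fin h} (R F T : Finset (Finset (Fin h))) (α β : Fin h → ℂ) (lam : Finset (Fin h) → Finset (Fin h))
    (hTF : T ⊆ delFam F vs)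
    (hsupp : ∀ Y ∈ delFam F vs, labelsW α β Y ⊆ linkFam F vs ∪ T.image lam)
    (hown : ∀ Y₀ ∈ T, ∀ Y ∈ delFam F vs, lam Y₀ ∈ labelsW α β Y → Y = Y₀)
    (hlamL : ∀ Y₀ ∈ T, lam Y₀ ∉ linkFam F vs)
    (hlamT : ∀ Y₀ ∈ T, lam Y₀ ∈ labelsW α β Y₀)
    {θ'' : Fin h → Fin h → ℂ} {φ'' : Fin h → Fin h → Fin h → ℂ} (hθ : ∀ γ, θ'' n γ = 0) (hφ : ∀ b γ, φ'' b γ n = 0)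
    (h0 : IndepColsR (delFam R n) (delFam F vs \ T) θ'' φ'')
    (h1 : IndepColsR (linkFam R n) (linkFam F vs ∪ T.image lam) θ'' φ'') :
    IndepColsR R F (apexThetaW θ'' vs n β) (apexPhiW φ'' vs n α) := by
  classical
  intro g hg
  set F' := delFam F vs with hF'
  set L := linkFam F vs with hL
  set M := L ∪ T.image lam with hM
  set t : Finset (Fin h) → Finset (Fin h) → ℂ := fun Y U => coeff (pexpo U ∅) (∏ γ ∈ Y, doorElem θ'' φ'' γ) with ht
  set c : Finset (Fin h) → ℂ := fun Y => ∑ γ ∈ Y, α γ with hc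
  -- the coefficient of the label `μ` in the bottom part of the column `Y`: `Σα` for `μ = Y`, `β_γ` for `μ = Y ∖ γ`
  set cf : Finset (Fin h) → Finset (Fin h) → ℂ := fun Y μ => if μ = Y then c Y else ∑ γ ∈ Y.filter (fun γ' => Y.erase γ' = μ), β γ with hcf
  -- split F into F' and the columns through vs
  have hsplit : ∀ U, ∑ W ∈ F, g W * coeff (pexpo U ∅) (∏ γ ∈ W, doorElem (apexThetaW θ'' vs n β) (apexPhiW φ'' vs n α) γ) =
      ∑ W ∈ F', g W * coeff (pexpo U ∅) (∏ γ ∈ W, doorElem (apexThetaW θ'' vs n β) (apexPhiW φ'' vs n α) γ) +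
      ∑ W ∈ F.filter (fun W => vs ∈ W), g W * coeff (pexpo U ∅) (∏ γ ∈ W, doorElem (apexThetaW θ'' vs n β) (apexPhiW φ'' vs n α) γ) := by
    intro U
    rw [hF', delFam, ← Finset.sum_filter_add_sum_filter_not F (fun W => vs ∉ W)]
    congr 1
    exact Finset.sum_congr (Finset.filter_congr (fun W _ => by rw [not_not])) (fun _ _ => rfl)
  -- (i) the bottom part of a column Y ∈ F', as a combination of its labels, all of which lie in M
  have hbot_col : ∀ Y ∈ F', ∀ U₀ : Finset (Fin h), n ∉ U₀ →
      coeff (pexpo (insert n U₀) ∅) (∏ γ ∈ Y, doorElem (apexThetaW θ'' vs n β) (apexPhiW φ'' vs n α) γ) =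
        ∑ μ ∈ M, (if μ ∈ labelsW α β Y then cf Y μ * t μ U₀ else 0) := by
    intro Y hY U₀ hnU₀
    have hvsY : vs ∉ Y := (mem_delFam.mp hY).2
    rw [coeff_prod_doorElem_apexW_notMem hvsY hθ hφ, if_pos (Finset.mem_insert_self n U₀), Finset.erase_insert hnU₀]
    -- restrict the sum over M to the labels of Y
    rw [← Finset.sum_filter, Finset.filter_mem_eq_inter, Finset.inter_eq_right.mpr (hsupp Y hY)]
    -- labels = ({Y} if Σα ≠ 0) ⊔ erased labels
    have hdisj : Disjoint (if (∑ γ ∈ Y, α γ) ≠ 0 then ({Y} : Finset (Finset (Fin h))) else ∅)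
        ((Y.filter (fun γ => β γ ≠ 0)).image (fun γ => Y.erase γ)) := by
      rw [Finset.disjoint_left]
      intro μ hμ hμ'
      obtain ⟨γ, hγ, rfl⟩ := Finset.mem_image.mp hμ'
      have hμY : Y.erase γ = Y := by
        by_cases hne : (∑ γ ∈ Y, α γ) ≠ 0
        · rw [if_pos hne, Finset.mem_singleton] at hμ; exact hμ
        · rw [if_neg hne] at hμ; exact absurd hμ (Finset.notMem_empty _)
      exact erase_ne_self_of_mem (Finset.mem_filter.mp hγ).1 hμY
    rw [labelsW, Finset.sum_union hdisj]
    congr 1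
    · -- the label Y itself
      by_cases hne : (∑ γ ∈ Y, α γ) ≠ 0
      · rw [if_pos hne, Finset.sum_singleton, hcf]
        simp only [if_true]
        rfl
      · rw [if_neg hne, Finset.sum_empty]
        have hc0 : ∑ γ ∈ Y, α γ = 0 := not_not.mp hne
        rw [hc0, zero_mul]
    · -- the erased labels
      rw [Finset.sum_image (fun γ hγ γ' hγ' heq => (Finset.erase_injOn Y (Finset.mem_filter.mp hγ).1 (Finset.mem_filter.mp hγ').1 heq))]
      rw [← Finset.sum_filter_add_sum_filter_not Y (fun γ => β γ ≠ 0)]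
      have hz : ∑ γ ∈ Y.filter (fun γ => ¬ β γ ≠ 0), β γ * t (Y.erase γ) U₀ = 0 :=
        Finset.sum_eq_zero (fun γ hγ => by rw [not_not.mp (Finset.mem_filter.mp hγ).2, zero_mul])
      rw [hz, add_zero]
      refine Finset.sum_congr rfl (fun γ hγ => ?_)
      have hγY : γ ∈ Y := (Finset.mem_filter.mp hγ).1
      rw [hcf]
      simp only [if_neg (erase_ne_self_of_mem hγY)]
      rw [filter_erase_eq_erase hγY, Finset.sum_singleton]
  -- (ii) the bottom equations: a vanishing combination of the columns of M on the rows linkFam R n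
  set Gf : Finset (Fin h) → ℂ := fun μ => (if μ ∈ L then g (insert vs μ) else 0) + ∑ Y ∈ F', (if μ ∈ labelsW α β Y then g Y * cf Y μ else 0)
    with hGf
  have hbot : ∀ U₀ ∈ linkFam R n, ∑ μ ∈ M, Gf μ * t μ U₀ = 0 := by
    intro U₀ hU₀
    obtain ⟨hnU₀, hins⟩ := mem_linkFam.mp hU₀
    have key := hg (insert n U₀) hins
    rw [hsplit] at key
    -- first block: columns of F'
    have hA : ∑ W ∈ F', g W * coeff (pexpo (insert n U₀) ∅) (∏ γ ∈ W, doorElem (apexThetaW θ'' vs n β) (apexPhiW φ'' vs n α) γ) =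
        ∑ μ ∈ M, (∑ Y ∈ F', (if μ ∈ labelsW α β Y then g Y * cf Y μ else 0)) * t μ U₀ := by
      rw [Finset.sum_congr rfl (fun W hW => by rw [hbot_col W hW U₀ hnU₀, Finset.mul_sum]), Finset.sum_comm]
      refine Finset.sum_congr rfl (fun μ _ => ?_)
      rw [Finset.sum_mul]
      refine Finset.sum_congr rfl (fun Y _ => ?_)
      split_ifs <;> ring
    -- second block: columns through vs, reindexed by the link
    have hB : ∑ W ∈ F.filter (fun W => vs ∈ W), g W * coeff (pexpo (insert n U₀) ∅)
        (∏ γ ∈ W, doorElem (apexThetaW θ'' vs n β) (apexPhiW φ'' vs n α) γ) = ∑ μ ∈ M, (if μ ∈ L then g (insert vs μ) else 0) * t μ U₀ := by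
      have hLM : ∑ μ ∈ M, (if μ ∈ L then g (insert vs μ) else 0) * t μ U₀ = ∑ μ ∈ L, g (insert vs μ) * t μ U₀ := by
        rw [← Finset.sum_filter_add_sum_filter_not M (fun μ => μ ∈ L)]
        have hz : ∑ μ ∈ M.filter (fun μ => μ ∉ L), (if μ ∈ L then g (insert vs μ) else 0) * t μ U₀ = 0 :=
          Finset.sum_eq_zero (fun μ hμ => by rw [if_neg (Finset.mem_filter.mp hμ).2, zero_mul])
        rw [hz, add_zero, Finset.filter_mem_eq_inter, Finset.inter_eq_right.mpr Finset.subset_union_left]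
        exact Finset.sum_congr rfl (fun μ hμ => by rw [if_pos hμ])
      rw [hLM, hL, linkFam, Finset.sum_image]
      · refine Finset.sum_congr rfl (fun W hW => ?_)
        have hvsW : vs ∈ W := (Finset.mem_filter.mp hW).2
        rw [coeff_prod_doorElem_apexW_mem hvsW hθ hφ, if_pos (Finset.mem_insert_self n U₀), Finset.erase_insert hnU₀, Finset.insert_erase hvsW]
      · intro W hW W' hW' heq
        exact Finset.erase_injOn' vs (Finset.mem_filter.mp hW).2 (Finset.mem_filter.mp hW').2 heq
    rw [hA, hB, ← Finset.sum_add_distrib] at key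
    rw [← key]
    refine Finset.sum_congr rfl (fun μ _ => ?_)
    rw [hGf]
    ring
  have hzero1 := h1 Gf hbot
  -- (iii) the coefficients on T vanish: the chosen label of Y₀ is owned by Y₀ alone, with a nonzero coefficient
  have hgT : ∀ Y₀ ∈ T, g Y₀ = 0 := by
    intro Y₀ hY₀
    have hμM : lam Y₀ ∈ M := Finset.mem_union_right _ (Finset.mem_image_of_mem lam hY₀)
    have := hzero1 (lam Y₀) hμM
    rw [hGf] at this
    simp only at this
    rw [if_neg (hlamL Y₀ hY₀), zero_add, Finset.sum_eq_single_of_mem Y₀ (hTF hY₀)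
      (fun Y hY hne => if_neg (fun hmem => hne (hown Y₀ hY₀ Y hY hmem))), if_pos (hlamT Y₀ hY₀)] at this
    have hcf0 : cf Y₀ (lam Y₀) ≠ 0 := by
      rw [hcf]
      simp only
      by_cases heq : lam Y₀ = Y₀
      · rw [if_pos heq]
        -- lam Y₀ = Y₀ is a label of Y₀ only through the tail part
        rcases mem_labelsW.mp (hlamT Y₀ hY₀) with ⟨-, hne⟩ | ⟨γ, hγ, -, hγeq⟩
        · exact hne
        · exact absurd (hγeq.trans heq) (erase_ne_self_of_mem hγ)
      · rw [if_neg heq]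
        rcases mem_labelsW.mp (hlamT Y₀ hY₀) with ⟨heq', -⟩ | ⟨γ, hγ, hβ, hγeq⟩
        · exact absurd heq' heq
        · rw [← hγeq, filter_erase_eq_erase hγ, Finset.sum_singleton]; exact hβ
    rcases mul_eq_zero.mp this with h' | h'
    · exact h'
    · exact absurd h' hcf0
  -- (iv) the top equations: a vanishing combination of the columns of F' \ T on the rows delFam R n
  have htop : ∀ U ∈ delFam R n, ∑ W ∈ F' \ T, g W * t W U = 0 := by
    intro U hU
    have hnU : n ∉ U := (mem_delFam.mp hU).2
    have key := hg U (mem_delFam.mp hU).1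
    rw [hsplit] at key
    have hB : ∑ W ∈ F.filter (fun W => vs ∈ W), g W * coeff (pexpo U ∅)
        (∏ γ ∈ W, doorElem (apexThetaW θ'' vs n β) (apexPhiW φ'' vs n α) γ) = 0 :=
      Finset.sum_eq_zero (fun W hW => by
        rw [coeff_prod_doorElem_apexW_mem (Finset.mem_filter.mp hW).2 hθ hφ, if_neg hnU, mul_zero])
    rw [hB, add_zero] at key
    have hA : ∑ W ∈ F', g W * coeff (pexpo U ∅) (∏ γ ∈ W, doorElem (apexThetaW θ'' vs n β) (apexPhiW φ'' vs n α) γ) =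
        ∑ W ∈ F', g W * t W U :=
      Finset.sum_congr rfl (fun W hW => by rw [coeff_prod_doorElem_apexW_notMem (mem_delFam.mp hW).2 hθ hφ, if_neg hnU])
    rw [hA] at key
    have hT0 : ∑ Y ∈ T, g Y * t Y U = 0 := Finset.sum_eq_zero (fun Y hY => by rw [hgT Y hY, zero_mul])
    rw [← Finset.sum_sdiff hTF, hT0, add_zero] at key
    exact key
  have hzero0 := h0 g htop
  have hgF' : ∀ Y ∈ F', g Y = 0 := by
    intro Y hY
    by_cases hYT : Y ∈ T
    · exact hgT Y hYT
    · exact hzero0 Y (Finset.mem_sdiff.mpr ⟨hY, hYT⟩)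
  -- (v) conclude
  intro W hW
  by_cases hvsW : vs ∈ W
  · have hYL : W.erase vs ∈ L := mem_linkFam.mpr ⟨Finset.notMem_erase vs W, by rw [Finset.insert_erase hvsW]; exact hW⟩
    have := hzero1 (W.erase vs) (Finset.mem_union_left _ hYL)
    rw [hGf] at this
    simp only at this
    rw [if_pos hYL, Finset.insert_erase hvsW, Finset.sum_eq_zero (fun Y hY => by rw [hgF' Y hY, zero_mul, ite_self]), add_zero] at this
    exact this
  · exact hgF' W (mem_delFam.mpr ⟨hW, hvsW⟩)

end

end Summit.ValiantsHypothesis.ValiantsHypothesis.Theorems.BarrierLever.AnchoredPeeling
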